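import Mathlib

/-!
# SoloBlindDepthLemma — two independent `{p, q}`-units cannot both be deep at the place 2

Solo seat `solo-ABC-blind`, session 13: coordinate T51 of the seat's wall (§3, engine E24).

Bugeaud's refinement of the `p`-adic two-logarithm estimates by a parameter `E`
(Y. Bugeaud, *Math. Proc. Cambridge Philos. Soc.* **127** (1999), Thm 2; as printed in
Bennett–Bugeaud–Mignotte, *Ann. Sc. Norm. Super. Pisa* (5) **12** (2013), Thm 3.2, p. 945)
replaces the product `log A₁ · log A₂` of the two heights — the exact defect separating the
known side (`SoloBlindShapeBKnown`, `SoloBlindOmega3Known`) from `abc` at three primes — by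
`max {log A₁, log A₂}`, *provided* both members `α₁, α₂` of the linear form satisfy
`v_p(αᵢ^g - 1) ≥ E` with `E · log p` comparable to the heights.

For an `abc` triple supported on `{2, p, q}` the members are `{p, q}`-units and the place is
`2`.  This file proves the elementary obstruction to that hypothesis: if two multiplicatively
independent units `p^{x₁} Q^{y₁}`, `p^{x₂} Q^{y₂}` of `ℤ/2^E` (with `p` odd and `Q` ANY unit —
`q`, `q⁻¹`, `-q`, …) both square to `1` (in particular if both are `≡ ±1 (mod 2^E)`), then

`E ≤ v₂(p² - 1) + v₂(x₁ y₂ - x₂ y₁) ≤ v₂(p² - 1) + log₂ (x₁ y₂ - x₂ y₁)`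

(`twoadic_depth_le`, `twoadic_depth_le_log`).  So the depth `E` is bounded by the 2-adic
depth of the BASE `p` plus the logarithm of the exponent determinant: with exponents of size
`O(log c)` one has `E ≤ v₂(p² - 1) + O(log log c)`, never `E ≍ log c` for a generic base, and
Bugeaud's estimate degenerates to Bugeaud–Laurent 1996.  The proof is Cramer's rule in the
unit group followed by lifting the exponent at `2` (`padicValNat.pow_two_sub_one`).
-/

namespace Summit.ABC.ABC.Theorems

/-- Cramer's rule in a commutative ring: if `(P^x₁ Q^y₁)² = 1` and `(P^x₂ Q^y₂)² = 1` for units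
`P, Q`, then `P^(2 (x₁ y₂ - x₂ y₁)) = 1` (stated for `x₂ y₁ ≤ x₁ y₂`). -/
theorem pow_two_mul_det_eq_one {M : Type*} [CommRing M] {P Q : M} (hP : IsUnit P)
    (hQ : IsUnit Q) {x₁ y₁ x₂ y₂ : ℕ} (h₁ : (P ^ x₁ * Q ^ y₁) ^ 2 = 1)
    (h₂ : (P ^ x₂ * Q ^ y₂) ^ 2 = 1) (hle : x₂ * y₁ ≤ x₁ * y₂) :
    P ^ (2 * (x₁ * y₂ - x₂ * y₁)) = 1 := by
  obtain ⟨d, hd⟩ : ∃ d, x₁ * y₂ = x₂ * y₁ + d := ⟨x₁ * y₂ - x₂ * y₁, by omega⟩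
  have e₁ : P ^ (2 * (x₁ * y₂)) * Q ^ (2 * (y₁ * y₂)) = 1 := by
    calc P ^ (2 * (x₁ * y₂)) * Q ^ (2 * (y₁ * y₂)) = ((P ^ x₁ * Q ^ y₁) ^ 2) ^ y₂ := by ring
      _ = 1 := by rw [h₁, one_pow]
  have e₂ : P ^ (2 * (x₂ * y₁)) * Q ^ (2 * (y₁ * y₂)) = 1 := by
    calc P ^ (2 * (x₂ * y₁)) * Q ^ (2 * (y₁ * y₂)) = ((P ^ x₂ * Q ^ y₂) ^ 2) ^ y₁ := by ring
      _ = 1 := by rw [h₂, one_pow]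
  have e₃ : P ^ (2 * (x₁ * y₂)) = P ^ (2 * (x₂ * y₁)) :=
    (hQ.pow _).mul_left_inj.mp (e₁.trans e₂.symm)
  have hd' : x₁ * y₂ - x₂ * y₁ = d := by omega
  rw [hd']
  have e₄ : P ^ (2 * (x₂ * y₁)) * P ^ (2 * d) = P ^ (2 * (x₂ * y₁)) * 1 := by
    rw [mul_one, ← pow_add, ← e₃, hd]
    ring
  exact (hP.pow _).mul_right_inj.mp e₄

/-- Lifting the exponent at `2`, packaged: `v₂(p^(2d) - 1) = v₂(p² - 1) + v₂(d)` for odd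
`p > 1` and `d ≠ 0`. -/
theorem padicValNat_two_pow_two_mul_sub_one {p d : ℕ} (hp : Odd p) (hp1 : 1 < p)
    (hd : d ≠ 0) :
    padicValNat 2 (p ^ (2 * d) - 1) = padicValNat 2 (p ^ 2 - 1) + padicValNat 2 d := by
  have hx : ¬ 2 ∣ p := hp.not_two_dvd_nat
  have h1 := padicValNat.pow_two_sub_one hp1 hx (n := 2 * d) (by omega) (even_two_mul d)
  have h2 := padicValNat.pow_two_sub_one hp1 hx (n := 2) (by omega) even_two
  have h3 : padicValNat 2 (2 * d) = 1 + padicValNat 2 d := by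
    rw [padicValNat.mul (by norm_num) hd, padicValNat_self]
  have h4 : padicValNat 2 2 = 1 := padicValNat_self
  omega

/-- **Depth lemma (T51).**  `p` odd, `Q` any unit of `ℤ/2^E`; if the two units
`p^x₁ Q^y₁` and `p^x₂ Q^y₂` both square to `1` modulo `2^E` (e.g. both `≡ ±1`) and are
multiplicatively independent in the sense `x₂ y₁ < x₁ y₂`, then
`E ≤ v₂(p² - 1) + v₂(x₁ y₂ - x₂ y₁)`. -/
theorem twoadic_depth_le {p x₁ y₁ x₂ y₂ E : ℕ} {Q : ZMod (2 ^ E)} (hp : Odd p) (hp1 : 1 < p)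
    (hQ : IsUnit Q) (h₁ : ((p : ZMod (2 ^ E)) ^ x₁ * Q ^ y₁) ^ 2 = 1)
    (h₂ : ((p : ZMod (2 ^ E)) ^ x₂ * Q ^ y₂) ^ 2 = 1) (hlt : x₂ * y₁ < x₁ * y₂) :
    E ≤ padicValNat 2 (p ^ 2 - 1) + padicValNat 2 (x₁ * y₂ - x₂ * y₁) := by
  set d := x₁ * y₂ - x₂ * y₁ with hd_def
  have hd : d ≠ 0 := by omega
  have hP : IsUnit (p : ZMod (2 ^ E)) :=
    (ZMod.isUnit_iff_coprime p (2 ^ E)).mpr (Nat.Coprime.pow_right E hp.coprime_two_right)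
  have e := pow_two_mul_det_eq_one hP hQ h₁ h₂ hlt.le
  -- `2^E ∣ p^(2d) - 1`
  have hpow : 1 ≤ p ^ (2 * d) := Nat.one_le_pow _ _ (by omega)
  have hdvd : 2 ^ E ∣ p ^ (2 * d) - 1 := by
    rw [← ZMod.natCast_eq_zero_iff, Nat.cast_sub hpow]
    push_cast
    rw [e, sub_self]
  have hne : p ^ (2 * d) - 1 ≠ 0 := by
    have : p ^ 1 ≤ p ^ (2 * d) := Nat.pow_le_pow_right (by omega) (by omega)
    have : 1 < p ^ (2 * d) := lt_of_lt_of_le (by simpa using hp1) this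
    omega
  have hE : E ≤ padicValNat 2 (p ^ (2 * d) - 1) := (padicValNat_dvd_iff_le hne).mp hdvd
  rw [padicValNat_two_pow_two_mul_sub_one hp hp1 hd] at hE
  exact hE

/-- The same with the logarithm of the determinant: `E ≤ v₂(p² - 1) + log₂ (x₁ y₂ - x₂ y₁)`. -/
theorem twoadic_depth_le_log {p x₁ y₁ x₂ y₂ E : ℕ} {Q : ZMod (2 ^ E)} (hp : Odd p)
    (hp1 : 1 < p) (hQ : IsUnit Q) (h₁ : ((p : ZMod (2 ^ E)) ^ x₁ * Q ^ y₁) ^ 2 = 1)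
    (h₂ : ((p : ZMod (2 ^ E)) ^ x₂ * Q ^ y₂) ^ 2 = 1) (hlt : x₂ * y₁ < x₁ * y₂) :
    E ≤ padicValNat 2 (p ^ 2 - 1) + Nat.log 2 (x₁ * y₂ - x₂ * y₁) :=
  (twoadic_depth_le hp hp1 hQ h₁ h₂ hlt).trans
    (Nat.add_le_add_left (padicValNat_le_nat_log _) _)

/-- Symmetric packaging over an odd base `q` as the unit `Q`: for odd `p, q > 1` and exponent
vectors with `x₂ y₁ < x₁ y₂`, two relations `(p^xᵢ q^yᵢ)² ≡ 1 (mod 2^E)` force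
`E ≤ min (v₂(p² - 1) + v₂ d, v₂(q² - 1) + v₂ d)`, `d = x₁ y₂ - x₂ y₁`. -/
theorem twoadic_depth_le_min {p q x₁ y₁ x₂ y₂ E : ℕ} (hp : Odd p) (hp1 : 1 < p) (hq : Odd q)
    (hq1 : 1 < q) (h₁ : ((p : ZMod (2 ^ E)) ^ x₁ * (q : ZMod (2 ^ E)) ^ y₁) ^ 2 = 1)
    (h₂ : ((p : ZMod (2 ^ E)) ^ x₂ * (q : ZMod (2 ^ E)) ^ y₂) ^ 2 = 1)
    (hlt : x₂ * y₁ < x₁ * y₂) :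
    E ≤ min (padicValNat 2 (p ^ 2 - 1) + padicValNat 2 (x₁ * y₂ - x₂ * y₁))
      (padicValNat 2 (q ^ 2 - 1) + padicValNat 2 (x₁ * y₂ - x₂ * y₁)) := by
  have hQ : IsUnit (q : ZMod (2 ^ E)) :=
    (ZMod.isUnit_iff_coprime q (2 ^ E)).mpr (Nat.Coprime.pow_right E hq.coprime_two_right)
  have hP : IsUnit (p : ZMod (2 ^ E)) :=
    (ZMod.isUnit_iff_coprime p (2 ^ E)).mpr (Nat.Coprime.pow_right E hp.coprime_two_right)
  refine le_min (twoadic_depth_le hp hp1 hQ h₁ h₂ hlt) ?_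
  -- swap the roles of `p` and `q`: the units are `q^yᵢ p^xᵢ`, determinant `y₂ x₁ - y₁ x₂`.
  have h₁' : ((q : ZMod (2 ^ E)) ^ y₂ * (p : ZMod (2 ^ E)) ^ x₂) ^ 2 = 1 := by
    rw [mul_comm]; exact h₂
  have h₂' : ((q : ZMod (2 ^ E)) ^ y₁ * (p : ZMod (2 ^ E)) ^ x₁) ^ 2 = 1 := by
    rw [mul_comm]; exact h₁
  have hlt' : y₁ * x₂ < y₂ * x₁ := by
    rw [mul_comm y₁, mul_comm y₂]; exact hlt
  have := twoadic_depth_le hq hq1 hP h₁' h₂' hlt'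
  have hdet : y₂ * x₁ - y₁ * x₂ = x₁ * y₂ - x₂ * y₁ := by
    rw [mul_comm y₂, mul_comm y₁]
  rw [hdet] at this
  exact this

/-- The instance behind E24: on the shape `p^l + q^m = 2ⁿ` the ONE deep relation is
`p^l q^{-m} ≡ -1 (mod 2ⁿ)`; any second, independent relation `(p^x q^{-y})² ≡ 1 (mod 2ⁿ)`
(`x m ≠ y l`) forces `n ≤ v₂(p² - 1) + v₂(l y - x m)` or the symmetric bound — i.e. the
modulus depth `n ≍ log c` is paid by the base, not by the exponents. -/
theorem shapeB_second_unit_depth_le {p q l m n x y : ℕ} (hp : Odd p) (hp1 : 1 < p) (hq : Odd q)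
    (h : p ^ l + q ^ m = 2 ^ n)
    (h₂ : ((p : ZMod (2 ^ n)) ^ x * ((q : ZMod (2 ^ n))⁻¹) ^ y) ^ 2 = 1) (hlt : x * m < l * y) :
    n ≤ padicValNat 2 (p ^ 2 - 1) + padicValNat 2 (l * y - x * m) := by
  have hqc : Nat.Coprime q (2 ^ n) := Nat.Coprime.pow_right n hq.coprime_two_right
  have hQu : IsUnit (q : ZMod (2 ^ n)) := (ZMod.isUnit_iff_coprime q (2 ^ n)).mpr hqc
  have hqinv : (q : ZMod (2 ^ n)) * (q : ZMod (2 ^ n))⁻¹ = 1 := ZMod.coe_mul_inv_eq_one q hqc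
  have hQ : IsUnit ((q : ZMod (2 ^ n))⁻¹) := IsUnit.of_mul_eq_one_right _ hqinv
  -- the deep relation: p^l * (q⁻¹)^m = -1 in ZMod (2^n)
  have hrel : (p : ZMod (2 ^ n)) ^ l * ((q : ZMod (2 ^ n))⁻¹) ^ m = -1 := by
    have h0 : (2 : ZMod (2 ^ n)) ^ n = 0 := by
      have := ZMod.natCast_self (2 ^ n)
      push_cast at this
      exact this
    have hsum : ((p : ZMod (2 ^ n)) ^ l + (q : ZMod (2 ^ n)) ^ m) = 0 := by
      have := congrArg (fun t : ℕ => (t : ZMod (2 ^ n))) h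
      push_cast at this
      rw [this, h0]
    have hpl : (p : ZMod (2 ^ n)) ^ l = -(q : ZMod (2 ^ n)) ^ m := eq_neg_of_add_eq_zero_left hsum
    rw [hpl, neg_mul, ← mul_pow, hqinv, one_pow]
  have h₁ : ((p : ZMod (2 ^ n)) ^ l * ((q : ZMod (2 ^ n))⁻¹) ^ m) ^ 2 = 1 := by
    rw [hrel]; ring
  exact twoadic_depth_le hp hp1 hQ h₁ h₂ hlt

end Summit.ABC.ABC.Theorems
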